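import Summits.Ventures.YMGap.RobustBall.CentreTubeWindow
import Summits.Ventures.YMGap.RobustBall.CentreTubeMembers
import Summits.Ventures.YMGap.RobustBall.RectangleWitness
import Summits.Ventures.YMGap.RobustBall.LoopActivity
import HarnessLib

/-!
# RobustBall/CentreTubeWindowMembers — a NONZERO-`N`-ality multi-plaquette member of the windowed centre tube: the
# `1×2`-rectangle (Symanzik) action around any linkwise centre-blind action

HONEST FRAMING: venture file of the cell `pub-ymgap` (QuantumFields programme), track Y2 ROBUST-BALL, seat ds-4 g8.
WHAT THIS IS: the membership certificate closing rb-theory's T-P5 caveat («a `1×2` rectangle's defect sees two fluxes,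
so it is outside `IsFluxLocal`») in the POSITIVE for the windowed class: p1's `1×2`-rectangle action
`τ ∑_r (1 − Re tr U_∂r/N)` (`termPerturbation (rectFamily d L N τ)`, `RectangleWitness`; fundamental = nonzero `N`-ality)
has a twist defect that is a finite-range flux interaction — by Stokes on the `1×2` loop
(`loopSum_one_two : ∮_{∂(1×2)} k = curl k(p₁) + curl k(p₂)`) each rectangle term reads the two fluxes of its plaquettes —
with vertical window `2`, transverse extent `2`, bounds `|τ|`, and (crude) defect rows `≤ 18 d(d−1)|τ|`
(`isFluxLocalW_rectFamily`: `IsFluxLocalW 2 2 (18 d (d−1) |τ|)`).  Hence (`rectangleAction_wilsonLoop_le`): for every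
twist-blind `W_b` (adjoint couplings of ANY size, …), every `τ` and every torus,
`|⟨W_{R×T}⟩_{β, W_b + W_rect(τ), L}| ≤ (4 c^{⌈T/2⌉})^{#{r<R : 2∣r}}` at `c = 2(d−1)N|β| + 18d(d−1)|τ| ≤ 1`
(SU(2), `d = 4`, `β_W = 1/8`: `|τ| ≤ 1/1728` gives `c ≤ 7/8`).  WHAT THIS IS NOT: anything at weak coupling, continuum,
spectral or Clay; the row constant `18 d(d−1)` is a counting bound, not optimised.
-/

noncomputable section

open Finset
open Literature.MathematicalPhysics.QuantumLattice (fundamentalRep)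
open Literature.MathematicalPhysics.QuantumFieldTheory

namespace Summit.Ventures.YMGap.RobustBall

open ZN ZNFluxW

variable {d L N : ℕ}

/-! ### Stokes for the `1×2` loop -/

/-- **Stokes on the `1×2` rectangle**: `∮_{∂(1×2)} k = curl k (x; i, j) + curl k (x + e_j; i, j)`. [folklore] -/
theorem loopSum_one_two [NeZero N] (k : Edge d L → ZMod N) (x : Site d L) (i j : Fin d) :
    loopSum k x i j 1 2 = plaqSum k x i j + plaqSum k (x.shift j) i j := by
  have h2 : x + Pi.single j ((2 : ℕ) : ZMod L) = (x.shift j).shift j := by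
    simp only [Site.shift, Nat.cast_ofNat, add_assoc, ← Pi.single_add]; norm_num
  have h1 : x + Pi.single i ((1 : ℕ) : ZMod L) = x.shift i := by simp [Site.shift]
  have hc : (x.shift i).shift j = (x.shift j).shift i := by
    simp only [Site.shift, add_assoc]
    abel
  simp only [loopSum, lineSum, h1, h2, hc, plaqSum, add_zero]
  ring

/-- The flux of a flux configuration through the ORIENTED plaquette `(x; i, j)` (`i ≠ j` in either order). [folklore] -/
def fluxAt (φ : Plaquette d L → ZMod N) (x : Site d L) (i j : Fin d) : ZMod N :=
  if h : i < j then φ (x, ⟨(i, j), h⟩) else if h' : j < i then -φ (x, ⟨(j, i), h'⟩) else 0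

/-- The oriented plaquette `(x; i, j)` as an element of `Plaquette d L` (ordered plane). [folklore] -/
def plaqOf (x : Site d L) (i j : Fin d) (hij : i ≠ j) : Plaquette d L :=
  if h : i < j then (x, ⟨(i, j), h⟩) else (x, ⟨(j, i), lt_of_le_of_ne (not_lt.1 h) hij.symm⟩)

/-- `fluxAt (curl k) = plaqSum k` for `i ≠ j` (the reversed orientation flips the sign). [folklore] -/
theorem fluxAt_flux [NeZero N] (k : Edge d L → ZMod N) (x : Site d L) {i j : Fin d} (hij : i ≠ j) :
    fluxAt (flux k) x i j = plaqSum k x i j := by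
  unfold fluxAt flux
  by_cases h : i < j
  · simp [h]
  · have h' : j < i := lt_of_le_of_ne (not_lt.1 h) hij.symm
    simp only [h, dif_neg, not_false_eq_true, h', dif_pos, plaqSum]
    ring

/-- `fluxAt` reads `φ` only at `plaqOf`. [folklore] -/
theorem fluxAt_congr {φ φ' : Plaquette d L → ZMod N} (x : Site d L) {i j : Fin d} (hij : i ≠ j)
    (h : φ (plaqOf x i j hij) = φ' (plaqOf x i j hij)) : fluxAt φ x i j = fluxAt φ' x i j := by
  unfold fluxAt
  unfold plaqOf at h
  by_cases hlt : i < j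
  · simp only [hlt, dif_pos] at h ⊢; rw [h]
  · have h' : j < i := lt_of_le_of_ne (not_lt.1 hlt) hij.symm
    simp only [hlt, dif_neg, not_false_eq_true, h', dif_pos] at h ⊢; rw [h]

/-- The base point of `plaqOf x i j` is `x`. [folklore] -/
@[simp] theorem plaqOf_fst (x : Site d L) {i j : Fin d} (hij : i ≠ j) : (plaqOf x i j hij).1 = x := by
  unfold plaqOf; split_ifs <;> rfl

/-- The `i'`-sites of `plaqOf x i j` lie in `{x, x + e_i, x + e_j}`. [folklore] -/
theorem iSites_plaqOf_subset (i' : Fin d) (x : Site d L) {i j : Fin d} (hij : i ≠ j) :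
    iSites i' (plaqOf x i j hij) ⊆ {x, x.shift i, x.shift j} := by
  intro y hy
  simp only [Finset.mem_insert, Finset.mem_singleton]
  unfold plaqOf at hy
  split_ifs at hy with h
  · simp only [iSites] at hy
    split_ifs at hy <;>
      simp only [Finset.mem_insert, Finset.mem_singleton, Finset.notMem_empty] at hy <;> tauto
  · simp only [iSites] at hy
    split_ifs at hy <;>
      simp only [Finset.mem_insert, Finset.mem_singleton, Finset.notMem_empty] at hy <;> tauto

/-! ### The rectangle family as a finite-range flux defect -/

section Rect

variable [NeZero L] [NeZero N] (τ : ℝ)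

/-- Support of the rectangle `r = (x; i, j)`: its two plaquettes `(x; i, j)` and `(x + e_j; i, j)`. [folklore] -/
def rectSupp (r : Site d L × DirPair d) : Finset (Plaquette d L) :=
  {plaqOf r.1 r.2.1.1 r.2.1.2 r.2.2, plaqOf (r.1.shift r.2.1.2) r.2.1.1 r.2.1.2 r.2.2}

/-- Twist defect of the rectangle term: `−τ Re(ψ(φ_{p₁} + φ_{p₂}) tr U_∂r)/N`. [folklore] -/
def rectDefect (r : Site d L × DirPair d) (φ : Plaquette d L → ZMod N) (U : GaugeConfig d L (SUN N)) : ℝ :=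
  -τ * ((ψ N (fluxAt φ r.1 r.2.1.1 r.2.1.2 + fluxAt φ (r.1.shift r.2.1.2) r.2.1.1 r.2.1.2) *
    ((rectangleHolonomy U r.1 r.2.1.1 r.2.1.2 1 2 : SUN N) : Matrix (Fin N) (Fin N) ℂ).trace).re / N)

omit [NeZero L] in
/-- The rectangle defect reads the flux configuration only on its support. [folklore] -/
theorem dependsOn_rectDefect (r : Site d L × DirPair d) (U : GaugeConfig d L (SUN N)) :
    DependsOn (fun φ => rectDefect τ r φ U) (↑(rectSupp r) : Set (Plaquette d L)) := by
  intro φ φ' h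
  simp only [rectDefect]
  rw [fluxAt_congr r.1 r.2.2 (h _ (by simp [rectSupp])), fluxAt_congr (r.1.shift r.2.1.2) r.2.2 (h _ (by simp [rectSupp]))]

omit [NeZero L] in
/-- `|rectDefect| ≤ |τ|`. [folklore] -/
theorem abs_rectDefect_le (r : Site d L × DirPair d) (φ : Plaquette d L → ZMod N) (U : GaugeConfig d L (SUN N)) :
    |rectDefect τ r φ U| ≤ |τ| := by
  unfold rectDefect
  rw [abs_mul, abs_neg]
  refine mul_le_of_le_one_right (abs_nonneg τ) ?_
  rw [← trace_centreOf_mul]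
  exact abs_re_trace_div_le_one _

/-- **The twist defect of the rectangle action is the finite-range flux interaction `rectDefect`**:
`W_rect(ζ_k U) = #rectangles · τ + ∑_r rectDefect_r(curl k, U)`. [folklore] -/
theorem total_rectFamily_twist (k : Edge d L → ZMod N) (U : GaugeConfig d L (SUN N)) :
    (termPerturbation (rectFamily d L N τ)).total (twistOf k * U) =
      (Fintype.card (Site d L × DirPair d) : ℝ) * τ + ∑ r : Site d L × DirPair d, rectDefect τ r (flux k) U := by
  rw [total_termPerturbation]
  have hr : ∀ r : Site d L × DirPair d, (rectFamily d L N τ r).act (twistOf k * U) = τ + rectDefect τ r (flux k) U := by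
    intro r
    rw [rectFamily_act, rectangleActivity, rectangleHolonomy_mul_of_center _ _ (twistOf_mem_center k),
      rectangleHolonomy_twistOf, trace_centreOf_mul, loopSum_one_two, rectDefect, fluxAt_flux k _ r.2.2,
      fluxAt_flux k _ r.2.2]
    ring
  simp only [hr, Finset.sum_add_distrib, Finset.sum_const, Finset.card_univ, nsmul_eq_mul]

/-! ### Geometry of the supports: window `2`, extent `2`, rows `≤ 18 d(d−1)|τ|` -/

omit [NeZero L] in
/-- The `i'`-links of a rectangle support lie in the six-point set `{x, x+e_i, x+e_j, x+e_j, x+e_j+e_i, x+2e_j}`. [folklore] -/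
theorem mem_iLinks_rectSupp (i' : Fin d) (r : Site d L × DirPair d) {y : Site d L} (hy : y ∈ iLinks i' (rectSupp r)) :
    (y = r.1 ∨ y = r.1.shift r.2.1.1 ∨ y = r.1.shift r.2.1.2) ∨
      (y = r.1.shift r.2.1.2 ∨ y = (r.1.shift r.2.1.2).shift r.2.1.1 ∨ y = (r.1.shift r.2.1.2).shift r.2.1.2) := by
  rw [iLinks, rectSupp, Finset.mem_biUnion] at hy
  obtain ⟨p, hp, hyp⟩ := hy
  simp only [Finset.mem_insert, Finset.mem_singleton] at hp
  rcases hp with rfl | rfl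
  · left; simpa [Finset.mem_insert, Finset.mem_singleton] using iSites_plaqOf_subset i' r.1 r.2.2 hyp
  · right; simpa [Finset.mem_insert, Finset.mem_singleton] using iSites_plaqOf_subset i' _ r.2.2 hyp

omit [NeZero L] in
/-- The `i'`-HEIGHT of an `i'`-link of a rectangle support is `x_{i'}` or `x_{i'} + 1`. [folklore] -/
theorem apply_of_mem_iLinks_rectSupp (i' : Fin d) (r : Site d L × DirPair d) {y : Site d L}
    (hy : y ∈ iLinks i' (rectSupp r)) : y i' = r.1 i' ∨ y i' = r.1 i' + 1 := by
  obtain ⟨p, hp, hyp, hyi⟩ := apply_eq_of_mem_iLinks i' hy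
  simp only [rectSupp, Finset.mem_insert, Finset.mem_singleton] at hp
  rcases hp with rfl | rfl
  · left; rw [hyi, plaqOf_fst]
  · rw [hyi, plaqOf_fst]
    by_cases hj : r.2.1.2 = i'
    · right; simp [Site.shift, hj]
    · left; simp [Site.shift, Pi.single_eq_of_ne (Ne.symm hj)]

/-- **Vertical window `2`**: two `i'`-links of one rectangle support are at cyclic `i'`-distance `≤ 1`. [folklore] -/
theorem iDist_lt_two_rectSupp (i' : Fin d) (r : Site d L × DirPair d) {y y' : Site d L}
    (hy : y ∈ iLinks i' (rectSupp r)) (hy' : y' ∈ iLinks i' (rectSupp r)) : (y i' - y' i').valMinAbs.natAbs < 2 := by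
  have h1 : ((1 : ZMod L)).valMinAbs.natAbs ≤ 1 := natAbs_valMinAbs_one_le
  have h1' : ((-1 : ZMod L)).valMinAbs.natAbs ≤ 1 := by rw [ZMod.natAbs_valMinAbs_neg]; exact natAbs_valMinAbs_one_le
  rcases apply_of_mem_iLinks_rectSupp i' r hy with h | h <;>
    rcases apply_of_mem_iLinks_rectSupp i' r hy' with h' | h' <;> rw [h, h']
  · simp
  · rw [show r.1 i' - (r.1 i' + 1) = (-1 : ZMod L) by ring]; omega
  · rw [show r.1 i' + 1 - r.1 i' = (1 : ZMod L) by ring]; omega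
  · simp

omit [NeZero L] in
/-- Coordinates of a shifted site: `(x + e_v)_{j'} = x_{j'} + [v = j']`. [folklore] -/
theorem shift_apply_eq_add (x : Site d L) (v j' : Fin d) :
    (x.shift v) j' = x j' + ((if v = j' then 1 else 0 : ℕ) : ZMod L) := by
  by_cases h : v = j'
  · subst h; simp [Site.shift]
  · simp [Site.shift, h]

omit [NeZero L] in
/-- Every `i'`-link of a rectangle support has `j'`-coordinate `x_{j'} + a` with `a ≤ 2`. [folklore] -/
theorem exists_offset_of_mem_iLinks_rectSupp (i' j' : Fin d) (r : Site d L × DirPair d) {y : Site d L}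
    (hy : y ∈ iLinks i' (rectSupp r)) : ∃ a : ℕ, a ≤ 2 ∧ y j' = r.1 j' + (a : ZMod L) := by
  have key : ∀ (v w : Fin d), ∃ a : ℕ, a ≤ 2 ∧ ((r.1.shift v).shift w) j' = r.1 j' + (a : ZMod L) := by
    intro v w
    refine ⟨(if v = j' then 1 else 0) + (if w = j' then 1 else 0), by split_ifs <;> omega, ?_⟩
    rw [shift_apply_eq_add, shift_apply_eq_add, Nat.cast_add, add_assoc]
  have key1 : ∀ v : Fin d, ∃ a : ℕ, a ≤ 2 ∧ (r.1.shift v) j' = r.1 j' + (a : ZMod L) := fun v =>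
    ⟨if v = j' then 1 else 0, by split_ifs <;> omega, shift_apply_eq_add r.1 v j'⟩
  rcases mem_iLinks_rectSupp i' r hy with (h | h | h) | (h | h | h) <;> rw [h]
  · exact ⟨0, by omega, by simp⟩
  · exact key1 _
  · exact key1 _
  · exact key1 _
  · exact key _ _
  · exact key _ _

omit [NeZero N] in
/-- `|a − a'|_{ℤ/L} ≤ max a a'` for naturals `a, a'`. [folklore] -/
theorem natAbs_valMinAbs_natCast_sub_le (a a' : ℕ) :
    (((a : ℕ) : ZMod L) - ((a' : ℕ) : ZMod L)).valMinAbs.natAbs ≤ max a a' := by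
  rcases le_total a' a with h | h
  · rw [← Nat.cast_sub h]
    refine (natAbs_valMinAbs_le_val _).trans ?_
    rw [ZMod.val_natCast]; exact (Nat.mod_le _ _).trans (by omega)
  · rw [show ((a : ℕ) : ZMod L) - ((a' : ℕ) : ZMod L) = -(((a' - a : ℕ) : ℕ) : ZMod L) by rw [Nat.cast_sub h]; ring,
      ZMod.natAbs_valMinAbs_neg]
    refine (natAbs_valMinAbs_le_val _).trans ?_
    rw [ZMod.val_natCast]; exact (Nat.mod_le _ _).trans (by omega)

/-- **Transverse extent `2`**: two `i'`-links of one rectangle support are at `j'`-distance `≤ 2`. [folklore] -/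
theorem jDist_le_two_rectSupp (i' j' : Fin d) (r : Site d L × DirPair d) {y y' : Site d L}
    (hy : y ∈ iLinks i' (rectSupp r)) (hy' : y' ∈ iLinks i' (rectSupp r)) : jDist j' y' y ≤ 2 := by
  obtain ⟨a, ha, hya⟩ := exists_offset_of_mem_iLinks_rectSupp i' j' r hy
  obtain ⟨a', ha', hya'⟩ := exists_offset_of_mem_iLinks_rectSupp i' j' r hy'
  unfold jDist
  rw [hya, hya', show r.1 j' + (a : ZMod L) - (r.1 j' + (a' : ZMod L)) = (a : ZMod L) - (a' : ZMod L) by ring]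
  exact (natAbs_valMinAbs_natCast_sub_le a a').trans (max_le ha ha')

omit [NeZero L] in
/-- A rectangle support has at most `6` `i'`-links. [folklore] -/
theorem card_iLinks_rectSupp_le (i' : Fin d) (r : Site d L × DirPair d) : (iLinks i' (rectSupp r)).card ≤ 6 := by
  classical
  have hsub : iLinks i' (rectSupp r) ⊆ {r.1, r.1.shift r.2.1.1, r.1.shift r.2.1.2, r.1.shift r.2.1.2,
      (r.1.shift r.2.1.2).shift r.2.1.1, (r.1.shift r.2.1.2).shift r.2.1.2} := by
    intro y hy
    simp only [Finset.mem_insert, Finset.mem_singleton]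
    rcases mem_iLinks_rectSupp i' r hy with (h | h | h) | (h | h | h) <;> simp [h]
  exact (Finset.card_le_card hsub).trans Finset.card_le_six

/-- The base points of the rectangles whose support has `y` as an `i'`-link: five candidates per plane. [folklore] -/
def rectBase (y : Site d L) (q : DirPair d) : Fin 5 → Site d L
  | ⟨0, _⟩ => y
  | ⟨1, _⟩ => y - Pi.single q.1.1 1
  | ⟨2, _⟩ => y - Pi.single q.1.2 1
  | ⟨3, _⟩ => y - Pi.single q.1.2 1 - Pi.single q.1.1 1
  | ⟨4, _⟩ => y - Pi.single q.1.2 1 - Pi.single q.1.2 1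

omit [NeZero L] in
/-- Every rectangle whose support reads the `i'`-link `y` has base point among the five candidates. [folklore] -/
theorem mem_image_rectBase (i' : Fin d) (y : Site d L) {r : Site d L × DirPair d} (hy : y ∈ iLinks i' (rectSupp r)) :
    r ∈ (Finset.univ : Finset (DirPair d × Fin 5)).image fun qc => (rectBase y qc.1 qc.2, qc.1) := by
  rw [Finset.mem_image]
  obtain ⟨x, q⟩ := r
  rcases mem_iLinks_rectSupp i' (x, q) hy with (h | h | h) | (h | h | h)
  · exact ⟨(q, 0), Finset.mem_univ _, by simp [rectBase, h]⟩
  · exact ⟨(q, 1), Finset.mem_univ _, by simp [rectBase, h, Site.shift]⟩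
  · exact ⟨(q, 2), Finset.mem_univ _, by simp [rectBase, h, Site.shift]⟩
  · exact ⟨(q, 2), Finset.mem_univ _, by simp [rectBase, h, Site.shift]⟩
  · exact ⟨(q, 3), Finset.mem_univ _, by simp only [rectBase, h, Site.shift, Prod.mk.injEq, and_true]; abel⟩
  · exact ⟨(q, 4), Finset.mem_univ _, by simp [rectBase, h, Site.shift]⟩

/-- **At most `5 d(d−1)` rectangles read a given `i'`-link.** [folklore] -/
theorem card_filter_mem_iLinks_rectSupp_le (i' : Fin d) (y : Site d L) :
    ((Finset.univ : Finset (Site d L × DirPair d)).filter fun r => y ∈ iLinks i' (rectSupp r)).card ≤ 5 * (d * (d - 1)) := by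
  classical
  calc ((Finset.univ : Finset (Site d L × DirPair d)).filter fun r => y ∈ iLinks i' (rectSupp r)).card
      ≤ ((Finset.univ : Finset (DirPair d × Fin 5)).image fun qc => (rectBase y qc.1 qc.2, qc.1)).card :=
        Finset.card_le_card fun r hr => mem_image_rectBase i' y (Finset.mem_filter.1 hr).2
    _ ≤ (Finset.univ : Finset (DirPair d × Fin 5)).card := Finset.card_image_le
    _ = 5 * (d * (d - 1)) := by rw [Finset.card_univ, Fintype.card_prod, Fintype.card_fin, card_dirPair]; ring

/-- **Defect rows of the rectangle action**: `≤ 25 d(d−1)|τ|`. [folklore] -/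
theorem rows_rectDefect_le (i' : Fin d) (y : Site d L) :
    ∑ r ∈ (Finset.univ : Finset (Site d L × DirPair d)).filter (fun r => y ∈ iLinks i' (rectSupp r)),
      |τ| * (((iLinks i' (rectSupp r)).card : ℝ) - 1) ≤ 25 * ((d : ℝ) * ((d : ℝ) - 1)) * |τ| := by
  classical
  calc ∑ r ∈ (Finset.univ : Finset (Site d L × DirPair d)).filter (fun r => y ∈ iLinks i' (rectSupp r)),
        |τ| * (((iLinks i' (rectSupp r)).card : ℝ) - 1)
      ≤ ∑ r ∈ (Finset.univ : Finset (Site d L × DirPair d)).filter (fun r => y ∈ iLinks i' (rectSupp r)), |τ| * 5 := by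
        refine Finset.sum_le_sum fun r _ => mul_le_mul_of_nonneg_left ?_ (abs_nonneg τ)
        have h6 : ((iLinks i' (rectSupp r)).card : ℝ) ≤ 6 := by exact_mod_cast card_iLinks_rectSupp_le i' r
        linarith
    _ = |τ| * 5 * (((Finset.univ : Finset (Site d L × DirPair d)).filter fun r => y ∈ iLinks i' (rectSupp r)).card : ℝ) := by
        rw [Finset.sum_const, nsmul_eq_mul]; ring
    _ ≤ |τ| * 5 * (5 * (d * (d - 1)) : ℕ) := by
        refine mul_le_mul_of_nonneg_left ?_ (by positivity)
        exact_mod_cast card_filter_mem_iLinks_rectSupp_le i' y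
    _ = 25 * ((d : ℝ) * ((d : ℝ) - 1)) * |τ| := by
        rcases Nat.eq_zero_or_pos d with hd | hd
        · subst hd; simp
        · rw [Nat.cast_mul, Nat.cast_mul, Nat.cast_sub hd]; push_cast; ring

/-! ### The member theorem and the named bound -/

/-- **THE `1×2`-RECTANGLE ACTION IS IN THE WINDOWED CENTRE TUBE**: for every `τ`, every `N ≥ 1`, `d`, torus `L`:
`IsFluxLocalW 2 2 (25 d(d−1)|τ|) (termPerturbation (rectFamily d L N τ))` — a nonzero-`N`-ality, two-plaquette member. [folklore] -/
theorem isFluxLocalW_rectFamily : IsFluxLocalW 2 2 (25 * ((d : ℝ) * ((d : ℝ) - 1)) * |τ|) (termPerturbation (rectFamily d L N τ)) :=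
  isFluxLocalW_of_family (fun _ => (Fintype.card (Site d L × DirPair d) : ℝ) * τ) rectSupp (rectDefect τ) (fun _ => |τ|)
    (dependsOn_rectDefect τ) (fun _ => abs_nonneg τ) (abs_rectDefect_le τ) (fun r i' _ hy _ hy' => iDist_lt_two_rectSupp i' r hy hy')
    (fun r i' j' _ hy _ hy' => jDist_le_two_rectSupp i' j' r hy hy') (rows_rectDefect_le τ) (total_rectFamily_twist τ)

/-- **A twist-blind action of ANY size plus the `1×2`-rectangle action** is in the windowed centre tube. [folklore] -/
theorem isFluxLocalW_twistBlind_add_rectFamily {Wb : Perturbation d L N} (hb : IsTwistBlind Wb) :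
    IsFluxLocalW 2 2 (25 * ((d : ℝ) * ((d : ℝ) - 1)) * |τ|) (Wb + termPerturbation (rectFamily d L N τ)) :=
  IsFluxLocalW.twistBlind_add hb (isFluxLocalW_rectFamily τ)

/-- **AREA-LAW BOUND FOR WILSON + ANY CENTRE-BLIND ACTION + THE `1×2`-RECTANGLE (SYMANZIK) TERM** (`N ≥ 2`): at
`c = 2(d−1)N|β| + 25 d(d−1)|τ| ≤ 1`, every torus, every non-wrapping `R × T` loop:
`|⟨W_{R×T}⟩_{β, W_b + W_rect(τ), L}| ≤ (4 c^{⌈T/2⌉})^{#{r<R : 2∣r}}` — window `2`, extent `2`. [folklore] -/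
theorem rectangleAction_wilsonLoop_le (hN : 2 ≤ N) {β c : ℝ} {Wb : Perturbation d L N} (hb : IsTwistBlind Wb)
    (hc : 2 * ((d - 1 : ℕ) : ℝ) * |β| * N + 25 * ((d : ℝ) * ((d : ℝ) - 1)) * |τ| ≤ c) (hc1 : c ≤ 1) (x : Site d L)
    {i j : Fin d} (hij : i ≠ j) {R T : ℕ} (hR : 2 * R ≤ L) (hT : 2 * T ≤ L) :
    |(Wb + termPerturbation (rectFamily d L N τ)).expectation (fundamentalRep (Fin N)) β
        (wilsonLoop (fundamentalRep (Fin N)) x i j R T)| ≤ (4 * c ^ ((T + 2 - 1) / 2)) ^ (selIdx 2 R).card :=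
  abs_wilsonLoop_le_of_isFluxLocalW hN (by norm_num) (by norm_num) hc hc1 _ (isFluxLocalW_twistBlind_add_rectFamily τ hb)
    x hij hR hT

/-- **SU(2), `d = 4`, `β_W = 1/8` (tree `β = 1/16`), `|τ| ≤ 1/2400`**: `c ≤ 7/8`, so for every twist-blind `W_b` and every
torus `|⟨W_{R×T}⟩_{1/16, W_b + W_rect(τ), L}| ≤ (4 (7/8)^{⌈T/2⌉})^{#{r<R : 2∣r}}`. [folklore] -/
theorem su2_rectangleAction_wilsonLoop_le {τ : ℝ} (hτ : |τ| ≤ 1 / 2400) {Wb : Perturbation 4 L 2} (hb : IsTwistBlind Wb)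
    (x : Site 4 L) {i j : Fin 4} (hij : i ≠ j) {R T : ℕ} (hR : 2 * R ≤ L) (hT : 2 * T ≤ L) :
    |(Wb + termPerturbation (rectFamily 4 L 2 τ)).expectation (fundamentalRep (Fin 2)) (1 / 16)
        (wilsonLoop (fundamentalRep (Fin 2)) x i j R T)| ≤ (4 * (7 / 8 : ℝ) ^ ((T + 2 - 1) / 2)) ^ (selIdx 2 R).card :=
  rectangleAction_wilsonLoop_le τ (le_refl 2) hb (by norm_num [abs_of_pos]; linarith) (by norm_num) x hij hR hT

end Rect

/-! ### All at once: centre-blind action + bond disorder + the rectangle term -/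

/-- **COMBINED MEMBER**: a twist-blind action `W_b` of ANY size (e.g. adjoint couplings) + a bond-disordered Wilson detuning
`W_δ` (`|δ_q| ≤ δ`) + the `1×2`-rectangle action of size `τ` is in the windowed tube
`IsFluxLocalW 2 2 (2(d−1)Nδ + 25 d(d−1)|τ|)`. [folklore] -/
theorem isFluxLocalW_blind_detune_rect [NeZero L] [NeZero N] (τ : ℝ) {δ : Plaquette d L → ℝ} {δ₀ : ℝ} (hδ₀ : 0 ≤ δ₀)
    (hδ : ∀ q, |δ q| ≤ δ₀) {Wb Wδ : Perturbation d L N} (hb : IsTwistBlind Wb)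
    (hW : IsPlaquetteFamilyAction (detuneDensity δ) Wδ) :
    IsFluxLocalW 2 2 (2 * ((d - 1 : ℕ) : ℝ) * ((N : ℝ) * δ₀) + 25 * ((d : ℝ) * ((d : ℝ) - 1)) * |τ|)
      (Wb + Wδ + termPerturbation (rectFamily d L N τ)) := by
  have h1 : IsFluxLocalW 1 1 (2 * ((d - 1 : ℕ) : ℝ) * ((N : ℝ) * δ₀)) (Wb + Wδ) :=
    IsFluxLocalW.twistBlind_add hb ((isFluxLocal_of_detune hδ hW).isFluxLocalW (by positivity))
  have h2 := h1.add (isFluxLocalW_rectFamily (d := d) (L := L) (N := N) τ)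
  simpa using h2

/-- **AREA-LAW BOUND FOR WILSON + CENTRE-BLIND + BOND DISORDER + RECTANGLE TERM, all at once** (`N ≥ 2`): at
`c = 2(d−1)N(|β| + δ) + 25 d(d−1)|τ| ≤ 1`: `|⟨W_{R×T}⟩_{β, W_b + W_δ + W_rect(τ), L}| ≤ (4 c^{⌈T/2⌉})^{#{r<R : 2∣r}}`. [folklore] -/
theorem blindDetuneRect_wilsonLoop_le [NeZero L] [NeZero N] (hN : 2 ≤ N) (τ : ℝ) {β c δ₀ : ℝ} {δ : Plaquette d L → ℝ}
    (hδ₀ : 0 ≤ δ₀) (hδ : ∀ q, |δ q| ≤ δ₀) {Wb Wδ : Perturbation d L N} (hb : IsTwistBlind Wb)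
    (hW : IsPlaquetteFamilyAction (detuneDensity δ) Wδ)
    (hc : 2 * ((d - 1 : ℕ) : ℝ) * N * (|β| + δ₀) + 25 * ((d : ℝ) * ((d : ℝ) - 1)) * |τ| ≤ c) (hc1 : c ≤ 1) (x : Site d L)
    {i j : Fin d} (hij : i ≠ j) {R T : ℕ} (hR : 2 * R ≤ L) (hT : 2 * T ≤ L) :
    |(Wb + Wδ + termPerturbation (rectFamily d L N τ)).expectation (fundamentalRep (Fin N)) β
        (wilsonLoop (fundamentalRep (Fin N)) x i j R T)| ≤ (4 * c ^ ((T + 2 - 1) / 2)) ^ (selIdx 2 R).card :=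
  abs_wilsonLoop_le_of_isFluxLocalW hN (by norm_num) (by norm_num)
    (by rw [show 2 * ((d - 1 : ℕ) : ℝ) * |β| * N + (2 * ((d - 1 : ℕ) : ℝ) * ((N : ℝ) * δ₀) + 25 * ((d : ℝ) * ((d : ℝ) - 1)) * |τ|)
        = 2 * ((d - 1 : ℕ) : ℝ) * N * (|β| + δ₀) + 25 * ((d : ℝ) * ((d : ℝ) - 1)) * |τ| by ring]; exact hc)
    hc1 _ (isFluxLocalW_blind_detune_rect τ hδ₀ hδ hb hW) x hij hR hT

end Summit.Ventures.YMGap.RobustBall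

end
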